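import Literature.AlgebraicGeometry.HodgeTheory.FermatEigenspaceVanishing
import HarnessLib

/-!
# The invariant classes of the Fermat variety are ambient: `H²ʳ(X²ʳₘ(ℂ); ℂ)^{μₘ²ʳ⁺²} ⊆ ι^* H²ʳ(ℙ²ʳ⁺¹(ℂ); ℂ)` (Shioda 1979 §1; Ran 1980 Prop. 1.7 (i))

Family `hodge`, layer `Literature/AlgebraicGeometry/HodgeTheory`. PROOF FILE (theorems only; no
definition, no named fact, D-0026). T. Shioda, *The Hodge conjecture for Fermat varieties*,
Math. Ann. 245 (1979), §1 (1.3)–(1.4): `Hⁿ_prim(Xⁿₘ, ℂ) = ⊕_{α ∈ 𝔄ⁿₘ} V(α)` with `𝔄ⁿₘ` the characters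
ALL of whose coordinates are non-zero — so the trivial character `α = 0` does not occur in the
primitive cohomology, i.e. **the `μₘⁿ⁺²`-invariant classes of the middle cohomology of the
even-dimensional Fermat variety are the restrictions of the classes of the ambient projective space**
(`Hⁿ(Xⁿₘ)^{Gⁿₘ} = Hⁿ(ℙⁿ⁺¹) = ℂ hⁿᐟ²`, the quotient `Xⁿₘ/Gⁿₘ ≅ ℙⁿ` of Shioda, Proc. Japan Acad. 55A
(1979) §4); Z. Ran, *Cycles on Fermat hypersurfaces*, Compositio Math. 42 (1980), §1 Prop. 1.7 (i)
("the character decomposition of `Pₙ(Vⁿₘ)` is `⊕ {H_χ : χ relevant}`").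

This is the eigenspace input `hE0` of the tree's assembly of the Hodge conjecture for Fermat varieties
(`mem_algebraicClasses_fermat_middle_of_eigenspaces`, `Aoki1987_primePow_of_eigenspaces`,
`Aoki1987_primePow_of_claims`, `hodgeClasses_algebraic_fermat_of_claims_at`, files
`FermatHodgeConjectureAssembly` / `FermatHodgeConjectureAokiProofs`), stated there VERBATIM as
`fermatEigenspace m 0 (2 * p) ≤ LinearMap.range (complexBetti.map (hypersurfaceι (fermatPolynomial ℂ (2 * p) m)) (2 * p)).hom`
and so far undischarged; the sibling inputs `hE2` (`fermatEigenspace_eq_bot_of_apply_eq_zero`,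
`FermatEigenspaceVanishing`) and the line bound (`Ran1980_fermatEigenspace_le_span_holds`) are tree
theorems. The proof is the tree's proof of `hE2` read at the trivial character:

* `restrictCompl_eq_zero_of_mem_fermatEigenspace_zero` — **an invariant class dies on every affine
  piece `U_k = {x_k ≠ 0}`** (any dimension `N ≥ 1`, middle degree): along the equivariant lift
  `e : J → U_k(ℂ)` of the join `J = μₘ * ⋯ * μₘ` (`exists_joinMap`, `diagonalMap_comp_joinMap`) the
  Kronecker dual of `e^*(v|_{U_k})` is a covariant functional on `H_N(J; ℂ)` for the TRIVIAL character
  of the torus `μₘᴺ⁺¹` (`kroneckerPairing_map_mem_covariants`), and such functionals vanish because the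
  trivial character of `μₘ` does not occur in `H̃₀(μₘ)` (Milnor Thm. 9.1; the tree's
  `PhamBrieskorn.covariants_eq_bot_of_trivial`); `e^*` and the Kronecker map are injective
  (`map_joinMap_injective`, `kroneckerPairing_injective_of_field`);
* `fermatEigenspace_zero_le_span_map_hypersurfaceι`, `fermatEigenspace_zero_le_range_map_hypersurfaceι`
  — **hence `V(0) ⊆ H²ʳ(X²ʳₘ(ℂ); ℂ)` lies on the line of ambient classes** (`r, m ≥ 1`): the kernel of
  `H²ʳ(X²ʳₘ(ℂ)) → H²ʳ(U_k(ℂ))` is the line `ℂ · ι^* γ` (Thom–Gysin for the coordinate section and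
  Lefschetz below the middle, the tree's `ker_restrictCompl_fermatCoordHyperplane_le_span`);
* `finrank_fermatEigenspace_zero_le_one` — in particular `dim V(0) ≤ 1`.

## References

* [Shioda1979HodgeFermat] T. Shioda, The Hodge conjecture for Fermat varieties, Math. Ann. 245
  (1979) 175–184, §1 (1.3)–(1.4).
* [Shioda1979PJA] T. Shioda, The Hodge conjecture and the Tate conjecture for Fermat varieties,
  Proc. Japan Acad. 55A (1979) 111–114, §4.
* [Ran1980] Z. Ran, Cycles on Fermat hypersurfaces, Compositio Math. 42 (1980) 121–142, §1
  Lemma 1.4, (1.5), Prop. 1.7 (i).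
* [Milnor1968] J. Milnor, Singular Points of Complex Hypersurfaces, Ann. of Math. Studies 61
  (1968), §9 Thm. 9.1.
-/

noncomputable section

open CategoryTheory AlgebraicGeometry

namespace Literature.AlgebraicGeometry.HodgeTheory

open Literature.AlgebraicGeometry.Motives Literature.AlgebraicTopology.SingularHomology
open Literature.Geometry.ComplexAnalytic Literature.Geometry.ComplexAnalytic.PhamBrieskorn

variable {m : ℕ}

/-- **An invariant class of the middle cohomology dies on every affine piece `U_k(ℂ)`** (Fermat variety
`Xᴺₘ`, `N ≥ 1`, `m ≠ 0`): for `v ∈ V(0) ⊆ Hᴺ(Xᴺₘ(ℂ); ℂ)` the restriction `v|_{U_k} = 0` — the Kronecker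
dual of `e^*(v|_{U_k})` along the equivariant lift `e` of the join `μₘ * ⋯ * μₘ` is a covariant
functional on `H_N(J; ℂ)` for the trivial character, and these vanish (the trivial character of `μₘ`
does not occur in `H̃₀(μₘ)`). [cite: Shioda1979HodgeFermat, §1 (1.3)–(1.4)] [cite: Milnor1968, §9 Thm. 9.1]
[cite: Ran1980, §1 Prop. 1.7 (i)] -/
theorem restrictCompl_eq_zero_of_mem_fermatEigenspace_zero {N : ℕ} (hN : 1 ≤ N) (hm : m ≠ 0)
    (k : Fin (N + 2)) {d : ℕ} (hd : d = N) {v : complexBetti (fermatHypersurface N m) d}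
    (hv : v ∈ fermatEigenspace m (0 : Fin (N + 2) → ZMod m) d) :
    complexBetti.restrictCompl (fermatHypersurface N m) (fermatCoordHyperplane N m k) d v = 0 := by
  subst hd
  obtain ⟨n, rfl⟩ : ∃ n, d = n + 1 := ⟨d - 1, by omega⟩
  obtain ⟨θ, hθ⟩ := exists_torusCharacter_eq (n := n + 1) k (0 : Fin (n + 1 + 2) → ZMod m)
  obtain ⟨e, he⟩ := exists_joinMap (n := n + 1) hm k
  have hθj : ∀ ζ : rootsOfUnity m ℂ, θ (Pi.mulSingle (0 : Fin (n + 2)) ζ) = 1 :=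
    torusCharacter_mulSingle_eq_one k hθ 0 rfl
  have hcov := PhamBrieskorn.covariants_eq_bot_of_trivial (n := n) hm 0 θ hθj
  -- the functional `⟨(incl ∘ e)^* v, -⟩` is `θ`-covariant for the trivial `θ`, hence zero
  have hS : ∀ u, singularCohomology.map ℂ ℂ (diagonalMap (fermatPolynomial ℂ (n + 1) m)
      (fermatGroup_le_diagonalStabilizer m (fermatGroupEquiv m (Fin.insertNth k 1 u)).2)) (n + 1) v =
        ((θ u : ℂˣ) : ℂ) • v := by
    intro u
    rw [hθ u]
    exact (mem_fermatEigenspace_iff.mp hv) _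
  have hmem := kroneckerPairing_map_mem_covariants
    ((⟨Subtype.val, continuous_subtype_val⟩ :
      C(complexPointsCompl (fermatHypersurface (n + 1) m) (fermatCoordHyperplane (n + 1) m k),
        ComplexPoints (fermatHypersurface (n + 1) m))).comp e) (n + 1)
    (fun u ↦ diagonalMap (fermatPolynomial ℂ (n + 1) m)
      (fermatGroup_le_diagonalStabilizer m (fermatGroupEquiv m (Fin.insertNth k 1 u)).2))
    (fun u ↦ diagonalMap_comp_joinMap hm k he u) (fun u ↦ ((θ u : ℂˣ) : ℂ)) v hS
  rw [hcov, Submodule.mem_bot] at hmem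
  have h1 : singularCohomology.map ℂ ℂ ((⟨Subtype.val, continuous_subtype_val⟩ :
      C(complexPointsCompl (fermatHypersurface (n + 1) m) (fermatCoordHyperplane (n + 1) m k),
        ComplexPoints (fermatHypersurface (n + 1) m))).comp e) (n + 1) v = 0 :=
    kroneckerPairing_injective_of_field ℂ (join (fun _ : Fin (n + 2) ↦ m)) (n + 1) (by rw [hmem, map_zero])
  rw [singularCohomology.map_comp, ModuleCat.comp_apply] at h1
  exact map_joinMap_injective hm k he (n + 1) (by rw [map_zero]; exact h1)

/-- **`V(0)` lies on the line of ambient classes** (`Xⁿ⁺¹ₘ`, `n, m ≥ 1`, even degree `2p + 2 = n + 1`):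
there is `γ ∈ H²ᵖ⁺²(ℙⁿ⁺²(ℂ); ℂ)` with `ι^* γ ≠ 0` and `V(0) ⊆ ℂ · ι^* γ` — an invariant class dies on
`U₀(ℂ)` and the kernel of that restriction is the line `ℂ · ι^* γ`.
[cite: Shioda1979HodgeFermat, §1 (1.3)–(1.4)] [cite: Ran1980, §1 Lemma 1.4, (1.5) and Prop. 1.7 (i)] -/
theorem fermatEigenspace_zero_le_span_map_hypersurfaceι' {n : ℕ} (hn : 1 ≤ n) (hm : 1 ≤ m) {p : ℕ}
    (hp : 2 * p + 2 = n + 1) :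
    ∃ γ : complexBetti (projectiveSpace (n + 2) ℂ) (2 * p + 2),
      complexBetti.map (SmoothHypersurface.hypersurfaceι (fermatPolynomial ℂ (n + 1) m)) (2 * p + 2) γ ≠ 0 ∧
      fermatEigenspace m (0 : Fin (n + 1 + 2) → ZMod m) (2 * p + 2) ≤
        ℂ ∙ complexBetti.map (SmoothHypersurface.hypersurfaceι (fermatPolynomial ℂ (n + 1) m)) (2 * p + 2) γ := by
  obtain ⟨γ, hγ, hker⟩ := ker_restrictCompl_fermatCoordHyperplane_le_span (n := n) (m := m) hn hm 0 (p := p)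
    (by omega)
  refine ⟨γ, hγ, fun v hv ↦ hker ?_⟩
  rw [LinearMap.mem_ker]
  exact restrictCompl_eq_zero_of_mem_fermatEigenspace_zero (N := n + 1) (by omega) (by omega) 0 hp hv

/-- **`V(0) ⊆ H²ʳ(X²ʳₘ(ℂ); ℂ)` lies on the line of an ambient class** (`r, m ≥ 1`): Shioda's
`H²ʳ(X²ʳₘ)^{μₘ²ʳ⁺²} = ℂ hʳ`, inclusion form. [cite: Shioda1979HodgeFermat, §1 (1.3)–(1.4)]
[cite: Shioda1979PJA, §4] [cite: Ran1980, §1 Prop. 1.7 (i)] -/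
theorem fermatEigenspace_zero_le_span_map_hypersurfaceι (hm : 1 ≤ m) {r : ℕ} (hr : 1 ≤ r) :
    ∃ γ : complexBetti (projectiveSpace (2 * r + 1) ℂ) (2 * r),
      complexBetti.map (SmoothHypersurface.hypersurfaceι (fermatPolynomial ℂ (2 * r) m)) (2 * r) γ ≠ 0 ∧
      fermatEigenspace m (0 : Fin (2 * r + 2) → ZMod m) (2 * r) ≤
        ℂ ∙ complexBetti.map (SmoothHypersurface.hypersurfaceι (fermatPolynomial ℂ (2 * r) m)) (2 * r) γ := by
  obtain ⟨s, rfl⟩ : ∃ s, r = s + 1 := ⟨r - 1, by omega⟩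
  exact fermatEigenspace_zero_le_span_map_hypersurfaceι' (n := 2 * s + 1) (by omega) hm (p := s) (by omega)

/-- **Shioda: the invariant classes of the middle cohomology of the even-dimensional Fermat variety are
restricted from projective space** — `V(0) ⊆ ι^* H²ʳ(ℙ²ʳ⁺¹(ℂ); ℂ)` in `H²ʳ(X²ʳₘ(ℂ); ℂ)`, `r, m ≥ 1`;
the hypothesis `hE0` of `mem_algebraicClasses_fermat_middle_of_eigenspaces` verbatim.
[cite: Shioda1979HodgeFermat, §1 (1.3)–(1.4)] [cite: Shioda1979PJA, §4] [cite: Ran1980, §1 Prop. 1.7 (i)] -/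
theorem fermatEigenspace_zero_le_range_map_hypersurfaceι (hm : 1 ≤ m) {r : ℕ} (hr : 1 ≤ r) :
    fermatEigenspace m (0 : Fin (2 * r + 2) → ZMod m) (2 * r) ≤
      LinearMap.range (complexBetti.map
        (SmoothHypersurface.hypersurfaceι (fermatPolynomial ℂ (2 * r) m)) (2 * r)).hom := by
  obtain ⟨γ, -, hle⟩ := fermatEigenspace_zero_le_span_map_hypersurfaceι hm hr
  refine hle.trans ?_
  rw [Submodule.span_singleton_le_iff_mem]
  exact LinearMap.mem_range_self _ γ

/-- **`dim H²ʳ(X²ʳₘ(ℂ); ℂ)^{μₘ²ʳ⁺²} ≤ 1`** (`r, m ≥ 1`). [cite: Shioda1979HodgeFermat, §1 (1.3)–(1.4)]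
[cite: Shioda1979PJA, §4] -/
theorem finrank_fermatEigenspace_zero_le_one (hm : 1 ≤ m) {r : ℕ} (hr : 1 ≤ r) :
    Module.finrank ℂ ↥(fermatEigenspace m (0 : Fin (2 * r + 2) → ZMod m) (2 * r)) ≤ 1 := by
  obtain ⟨γ, -, hle⟩ := fermatEigenspace_zero_le_span_map_hypersurfaceι hm hr
  calc Module.finrank ℂ ↥(fermatEigenspace m (0 : Fin (2 * r + 2) → ZMod m) (2 * r))
      ≤ Module.finrank ℂ ↥(ℂ ∙ complexBetti.map
          (SmoothHypersurface.hypersurfaceι (fermatPolynomial ℂ (2 * r) m)) (2 * r) γ) :=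
        Submodule.finrank_mono hle
    _ ≤ ({complexBetti.map (SmoothHypersurface.hypersurfaceι (fermatPolynomial ℂ (2 * r) m)) (2 * r) γ} :
          Set (complexBetti (fermatHypersurface (2 * r) m) (2 * r))).toFinset.card := finrank_span_le_card _
    _ = 1 := by simp

/-- The prime-power / `0 < p` indexing of the assembly files: the conjunct `hE0` of the hypothesis `hE` of
`Aoki1987_primePow_of_claims` / `hodgeClasses_algebraic_fermat_of_claims_at`, for every `m ≥ 1` and
`p > 0`. [cite: Shioda1979HodgeFermat, §1 (1.3)–(1.4)] [cite: Ran1980, §1 Prop. 1.7 (i)] -/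
theorem fermatEigenspace_zero_le_range_of_pos [NeZero m] {p : ℕ} (hp : 0 < p) :
    fermatEigenspace m (0 : Fin (2 * p + 2) → ZMod m) (2 * p) ≤
      LinearMap.range (complexBetti.map
        (SmoothHypersurface.hypersurfaceι (fermatPolynomial ℂ (2 * p) m)) (2 * p)).hom :=
  fermatEigenspace_zero_le_range_map_hypersurfaceι NeZero.one_le hp

end Literature.AlgebraicGeometry.HodgeTheory

end
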